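import Summits.HubbardSuperconductivity.HubbardSuperconductivity.Theorems.AnisotropyChordBipartiteClassFunction
import Summits.HubbardSuperconductivity.HubbardSuperconductivity.Theorems.AnisotropyChordBipartiteHalfChain

/-!
# Route `AnisotropyChord`: TP-VT and (OM) on `K_{m,m}` in EVERY SECTOR and for ALL real anisotropies —
# the first all-sector vertex-transitive family (theory seat `hubbard-h0-rotor-theory-1`, cycle 6,
# THEOREM 1D + exact lumping, memo ROTOR-THEORY-6 §61)

**Theorem** (`completeBipartite_gramTP2`).  Let `m ≥ 1` and `H(Δ) = xxzHamiltonian 1 K_{m,m} (−1) Δ`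
(`K_{m,m} = completeEquipartiteGraph 2 m`, connected and vertex-transitive).  In ANY sector `S^z_tot = M`,
for ANY real `Δ₁ ≤ Δ₂` (rows) and `Δ₃ ≤ Δ₄` (columns) and normalised sector ground states `ψᵢ` of `H(Δᵢ)`,

  `|⟨ψ₁, ψ₄⟩| · |⟨ψ₂, ψ₃⟩| ≤ |⟨ψ₁, ψ₃⟩| · |⟨ψ₂, ψ₄⟩|`.

So the Gram kernel of every sector ground-state curve of `K_{m,m}` is TP₂ on the whole real line — the
theory seat's CONJECTURE TP-VT (`VertexTransitiveGroundStateGramTP2`, `…SpinMonotoneDefs`) on this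
family, without the window `[−1, 1]`; and (OM) follows (`completeBipartite_overlapMonotone`).

Proof = exact lumping + discrete Sturm comparison:
1. Perron–Frobenius: `ψᵢ = cᵢ ψ₀ⁱ` with `ψ₀ⁱ ≥ 0` real, strictly positive on the sector
   (`xxz_sector_perron_pos`), and `ψ₀ⁱ = Fᵢ ∘ A` is a function of the part occupation `A`
   (`…PartInvariance`, `cb_classFun`), mirror-symmetric, satisfying the lumped birth–death equation
   (`…BipartiteLumping`);
2. the folded occupancy chain is a monotonically tilted reversible birth–death chain, so by discrete
   Sturm comparison (`Literature…bd_mlr_pairs`, via `cb_halfChain_mlr`) the likelihood ratios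
   `F₂/F₁`, `F₄/F₃` are monotone on the lower half;
3. the mirror symmetry transports the same-sign property of the `2 × 2` minors to ALL pairs of classes,
   and the `2 × 2` Cauchy–Binet identity (`Literature…gram_tp2_of_sameSign`) sums them configuration by
   configuration; the unimodular scalars `cᵢ` drop out.

No window is needed because the Sturm argument uses only the sign of the couplings (stoquasticity for
all `Δ`) and the monotonicity of the lumped potential `Z(a) = (m/2−a)(m/2−(W−a))` on the half chain.
What this does NOT cover: `K_{m,m'}` with `m ≠ m'` (no mirror), other complete multipartite graphs,
tori.  F. Gantmacher, M. Krein (2002) Ch. II; S. Karlin (1968) Ch. 3; H. Tasaki (2020) §2.4.  No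
definition is introduced.
-/

set_option linter.dupNamespace false

noncomputable section

namespace Summit.HubbardSuperconductivity.HubbardSuperconductivity.Theorems.AnisotropyChord

open Matrix Complex Finset
open scoped ComplexOrder
open Literature.MathematicalPhysics.QuantumLattice Literature.Probability.LatticeModels
open Literature.Combinatorics.SimpleGraph (IsVertexTransitive)
open Literature.Analysis.TotalPositivity

variable {m : ℕ}

/-- The data of one sector ground state on `K_{m,m}` in the form needed by the Sturm step: a scalar,
the positive Perron vector and its class function (restated from `xxz_sector_perron_pos`,
`cb_classFun`, `cb_exists_config` in the index ranges of `cb_halfChain_mlr`). [folklore] -/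
theorem cb_state_data (hm : 0 < m) (W : ℕ) (hWm : W ≤ 2 * m)
    (hW : ∃ σ : TensorIndex (Fin 2 × Fin m) 2, (∑ z, (σ z : ℕ)) = W) (Δ : ℝ)
    {ψ : TensorIndex (Fin 2 × Fin m) 2 → ℂ}
    (gm : ψ ∈ spinZSector (Λ := Fin 2 × Fin m) 1 (((Fintype.card (Fin 2 × Fin m) * 1 : ℕ) : ℝ) / 2 - W))
    (ge : xxzHamiltonian 1 (SimpleGraph.completeEquipartiteGraph 2 m) (-1) Δ *ᵥ ψ =
      ((lowestEnergyInSector 1 (xxzHamiltonian 1 (SimpleGraph.completeEquipartiteGraph 2 m) (-1) Δ)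
        (((Fintype.card (Fin 2 × Fin m) * 1 : ℕ) : ℝ) / 2 - W) : ℝ) : ℂ) • ψ) :
    ∃ (c : ℂ) (ψ₀ : TensorIndex (Fin 2 × Fin m) 2 → ℂ) (F : ℕ → ℝ) (E : ℝ),
      ψ = c • ψ₀ ∧ (∀ σ, 0 ≤ (ψ₀ σ).re ∧ (ψ₀ σ).im = 0) ∧
      (∀ σ, (∑ z, (σ z : ℕ)) ≠ W → ψ₀ σ = 0) ∧
      (∀ τ : Fin 2 × Fin m → Fin 2, (∑ z, (τ z : ℕ)) = W →
        ψ₀ τ = ((F (Finset.univ.filter fun j : Fin m => τ (0, j) = 1).card : ℝ) : ℂ)) ∧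
      (∀ a, a + 1 = W - min W m → F a = 0) ∧
      (∀ a, W - min W m ≤ a → a ≤ W / 2 → 0 < F a) ∧
      (∀ a, a ≤ W → F (W - a) = F a) ∧
      (∀ a, W - min W m ≤ a → a ≤ W / 2 →
        E * F a = -(Δ * (((m : ℝ) / 2 - a) * ((m : ℝ) / 2 - ((W : ℝ) - a)))) * F a
          - (1 / 2) * ((a : ℝ) * ((m : ℝ) - ((W : ℝ) - a)) * F (a - 1)
            + ((m : ℝ) - a) * ((W : ℝ) - a) * F (a + 1))) := by
  set G := SimpleGraph.completeEquipartiteGraph 2 m with hGdef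
  have hG : G.Connected := completeEquipartiteGraph_connected le_rfl hm
  obtain ⟨ψ₀, hK, -, hnn, hpos, hoff, hH, huniq⟩ := xxz_sector_perron_pos G hG Δ W hW
  obtain ⟨c, hc⟩ := huniq ψ gm ge
  obtain ⟨F, hF1, hF0, hFpos, hFmir, hFeq⟩ := cb_classFun hm Δ W hK hnn hpos rfl hH
  -- nonempty / empty classes
  have hne : ∀ a, W - min W m ≤ a → a ≤ W / 2 →
      ∃ τ : Fin 2 × Fin m → Fin 2, (∑ z, (τ z : ℕ)) = W ∧
        (Finset.univ.filter fun j : Fin m => τ (0, j) = 1).card = a := by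
    intro a ha hau
    obtain ⟨τ, h0, h1⟩ := cb_exists_config (m := m) (a := a) (b := W - a) (by omega) (by omega)
    exact ⟨τ, by rw [cb_weight_eq, h0, h1]; omega, h0⟩
  have hempty : ∀ a, a + 1 = W - min W m →
      ¬ ∃ τ : Fin 2 × Fin m → Fin 2, (∑ z, (τ z : ℕ)) = W ∧
        (Finset.univ.filter fun j : Fin m => τ (0, j) = 1).card = a := by
    rintro a ha ⟨τ, hτ, h0⟩
    have h1 := cb_cnt_le τ 1
    rw [cb_weight_eq, h0] at hτ
    omega
  refine ⟨c, ψ₀, F, _, hc, hnn, hoff, hF1, fun a ha => hF0 a (hempty a ha), fun a ha hau => ?_, hFmir,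
    fun a ha hau => hFeq a (hne a ha hau)⟩
  obtain ⟨τ, hτ, h0⟩ := hne a ha hau
  have := hFpos τ hτ
  rwa [h0] at this

/-- Gram entries of multiples of real vectors: `⟨c ψ₀, c' ψ₀'⟩ = conj(c) c' Σ_σ Re ψ₀(σ) Re ψ₀'(σ)`.
[folklore] -/
theorem star_dotProduct_of_real_smul {ι : Type*} [Fintype ι] {c c' : ℂ} {ψ₀ ψ₀' : ι → ℂ}
    (h : ∀ σ, (ψ₀ σ).im = 0) (h' : ∀ σ, (ψ₀' σ).im = 0) :
    star (c • ψ₀) ⬝ᵥ (c' • ψ₀') = star c * c' * ((∑ σ, (ψ₀ σ).re * (ψ₀' σ).re : ℝ) : ℂ) := by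
  rw [star_smul, smul_dotProduct, dotProduct_smul, smul_smul, smul_eq_mul, dotProduct, Complex.ofReal_sum,
    mul_comm (star c)]
  congr 1
  refine Finset.sum_congr rfl fun σ _ => ?_
  rw [Pi.star_apply, Complex.ofReal_mul, Complex.star_def]
  apply Complex.ext <;> simp [Complex.mul_re, Complex.mul_im, h σ, h' σ]

/-- **TP-VT on `K_{m,m}`, every sector, all real anisotropies** (see the module docstring): for
`m ≥ 1`, any sector `M`, `Δ₁ ≤ Δ₂`, `Δ₃ ≤ Δ₄` and normalised sector ground states `ψᵢ` of
`xxzHamiltonian 1 (completeEquipartiteGraph 2 m) (−1) Δᵢ`: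
`|⟨ψ₁,ψ₄⟩| |⟨ψ₂,ψ₃⟩| ≤ |⟨ψ₁,ψ₃⟩| |⟨ψ₂,ψ₄⟩|`.  Theory seat memo ROTOR-THEORY-6 §61 (THEOREM 1D +
lumping (i)); Gantmacher–Krein Ch. II; Karlin Ch. 3. [folklore] -/
theorem completeBipartite_gramTP2 (hm : 0 < m) {M Δ₁ Δ₂ Δ₃ Δ₄ : ℝ} (h12 : Δ₁ ≤ Δ₂) (h34 : Δ₃ ≤ Δ₄)
    {ψ₁ ψ₂ ψ₃ ψ₄ : TensorIndex (Fin 2 × Fin m) 2 → ℂ}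
    (g₁m : ψ₁ ∈ spinZSector (Λ := Fin 2 × Fin m) 1 M) (g₁n : star ψ₁ ⬝ᵥ ψ₁ = 1)
    (g₁e : xxzHamiltonian 1 (SimpleGraph.completeEquipartiteGraph 2 m) (-1) Δ₁ *ᵥ ψ₁ =
      ((lowestEnergyInSector 1 (xxzHamiltonian 1 (SimpleGraph.completeEquipartiteGraph 2 m) (-1) Δ₁)
        M : ℝ) : ℂ) • ψ₁)
    (g₂m : ψ₂ ∈ spinZSector (Λ := Fin 2 × Fin m) 1 M) (_g₂n : star ψ₂ ⬝ᵥ ψ₂ = 1)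
    (g₂e : xxzHamiltonian 1 (SimpleGraph.completeEquipartiteGraph 2 m) (-1) Δ₂ *ᵥ ψ₂ =
      ((lowestEnergyInSector 1 (xxzHamiltonian 1 (SimpleGraph.completeEquipartiteGraph 2 m) (-1) Δ₂)
        M : ℝ) : ℂ) • ψ₂)
    (g₃m : ψ₃ ∈ spinZSector (Λ := Fin 2 × Fin m) 1 M) (_g₃n : star ψ₃ ⬝ᵥ ψ₃ = 1)
    (g₃e : xxzHamiltonian 1 (SimpleGraph.completeEquipartiteGraph 2 m) (-1) Δ₃ *ᵥ ψ₃ =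
      ((lowestEnergyInSector 1 (xxzHamiltonian 1 (SimpleGraph.completeEquipartiteGraph 2 m) (-1) Δ₃)
        M : ℝ) : ℂ) • ψ₃)
    (g₄m : ψ₄ ∈ spinZSector (Λ := Fin 2 × Fin m) 1 M) (_g₄n : star ψ₄ ⬝ᵥ ψ₄ = 1)
    (g₄e : xxzHamiltonian 1 (SimpleGraph.completeEquipartiteGraph 2 m) (-1) Δ₄ *ᵥ ψ₄ =
      ((lowestEnergyInSector 1 (xxzHamiltonian 1 (SimpleGraph.completeEquipartiteGraph 2 m) (-1) Δ₄)
        M : ℝ) : ℂ) • ψ₄) :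
    ‖star ψ₁ ⬝ᵥ ψ₄‖ * ‖star ψ₂ ⬝ᵥ ψ₃‖ ≤ ‖star ψ₁ ⬝ᵥ ψ₃‖ * ‖star ψ₂ ⬝ᵥ ψ₄‖ := by
  -- (the normalisations of ψ₂, ψ₃, ψ₄ are not needed: the inequality is homogeneous)
  -- the weight of the sector
  have hψ₁0 : ψ₁ ≠ 0 := by
    intro h; rw [h, dotProduct_zero] at g₁n; exact zero_ne_one g₁n
  obtain ⟨W, hW, hMW⟩ := exists_weight_of_mem_spinZSector g₁m hψ₁0
  subst hMW
  have hWm : W ≤ 2 * m := by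
    obtain ⟨σ, hσ⟩ := hW
    have h0 := cb_cnt_le σ 0
    have h1 := cb_cnt_le σ 1
    rw [cb_weight_eq] at hσ
    omega
  -- per-state data
  obtain ⟨c₁, φ₁, F₁, E₁, hc₁, hnn₁, hoff₁, hF₁, hz₁, hp₁, hmi₁, heq₁⟩ := cb_state_data hm W hWm hW Δ₁ g₁m g₁e
  obtain ⟨c₂, φ₂, F₂, E₂, hc₂, hnn₂, hoff₂, hF₂, hz₂, hp₂, hmi₂, heq₂⟩ := cb_state_data hm W hWm hW Δ₂ g₂m g₂e
  obtain ⟨c₃, φ₃, F₃, E₃, hc₃, hnn₃, hoff₃, hF₃, hz₃, hp₃, hmi₃, heq₃⟩ := cb_state_data hm W hWm hW Δ₃ g₃m g₃e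
  obtain ⟨c₄, φ₄, F₄, E₄, hc₄, hnn₄, hoff₄, hF₄, hz₄, hp₄, hmi₄, heq₄⟩ := cb_state_data hm W hWm hW Δ₄ g₄m g₄e
  -- half-chain MLR for rows and columns
  have mlr₁₂ := cb_halfChain_mlr m W hWm hz₂ hz₁ hp₂ hp₁ hmi₂ hmi₁ heq₂ heq₁ h12
  have mlr₃₄ := cb_halfChain_mlr m W hWm hz₄ hz₃ hp₄ hp₃ hmi₄ hmi₃ heq₄ heq₃ h34
  -- the fold map `r a = min a (W − a)` and `F a = F (r a)`
  have hfold : ∀ {F : ℕ → ℝ}, (∀ a, a ≤ W → F (W - a) = F a) → ∀ a, a ≤ W → F a = F (min a (W - a)) := by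
    intro F hmir a ha
    rcases le_total a (W - a) with h | h
    · rw [min_eq_left h]
    · rw [min_eq_right h, hmir a ha]
  have hr_range : ∀ τ : Fin 2 × Fin m → Fin 2, (∑ z, (τ z : ℕ)) = W →
      (Finset.univ.filter fun j : Fin m => τ (0, j) = 1).card ≤ W ∧
      W - min W m ≤ min ((Finset.univ.filter fun j : Fin m => τ (0, j) = 1).card)
        (W - (Finset.univ.filter fun j : Fin m => τ (0, j) = 1).card) ∧
      min ((Finset.univ.filter fun j : Fin m => τ (0, j) = 1).card)
        (W - (Finset.univ.filter fun j : Fin m => τ (0, j) = 1).card) ≤ W / 2 := by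
    intro τ hτ
    have h0 := cb_cnt_le τ 0
    have h1 := cb_cnt_le τ 1
    rw [cb_weight_eq] at hτ
    refine ⟨by omega, by omega, by omega⟩
  -- same-signed minors, configuration by configuration
  have hsign : ∀ σ σ' : Fin 2 × Fin m → Fin 2,
      0 ≤ ((φ₁ σ).re * (φ₂ σ').re - (φ₁ σ').re * (φ₂ σ).re) *
        ((φ₃ σ).re * (φ₄ σ').re - (φ₃ σ').re * (φ₄ σ).re) := by
    intro σ σ'
    by_cases hσ : (∑ z, (σ z : ℕ)) = W
    swap
    · rw [hoff₁ σ hσ, hoff₂ σ hσ, hoff₃ σ hσ, hoff₄ σ hσ]; simp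
    by_cases hσ' : (∑ z, (σ' z : ℕ)) = W
    swap
    · rw [hoff₁ σ' hσ', hoff₂ σ' hσ', hoff₃ σ' hσ', hoff₄ σ' hσ']; simp
    rw [hF₁ σ hσ, hF₂ σ hσ, hF₃ σ hσ, hF₄ σ hσ, hF₁ σ' hσ', hF₂ σ' hσ', hF₃ σ' hσ', hF₄ σ' hσ']
    simp only [Complex.ofReal_re]
    obtain ⟨haW, hb1, hb2⟩ := hr_range σ hσ
    obtain ⟨haW', hb1', hb2'⟩ := hr_range σ' hσ'
    rw [hfold hmi₁ _ haW, hfold hmi₂ _ haW, hfold hmi₃ _ haW, hfold hmi₄ _ haW,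
      hfold hmi₁ _ haW', hfold hmi₂ _ haW', hfold hmi₃ _ haW', hfold hmi₄ _ haW']
    set b := min ((Finset.univ.filter fun j : Fin m => σ (0, j) = 1).card)
      (W - (Finset.univ.filter fun j : Fin m => σ (0, j) = 1).card)
    set b' := min ((Finset.univ.filter fun j : Fin m => σ' (0, j) = 1).card)
      (W - (Finset.univ.filter fun j : Fin m => σ' (0, j) = 1).card)
    rcases le_total b b' with hbb | hbb
    · have e1 := mlr₁₂ b b' hb1 hbb hb2'   -- F₂ b * F₁ b' ≤ F₂ b' * F₁ b
      have e2 := mlr₃₄ b b' hb1 hbb hb2'   -- F₄ b * F₃ b' ≤ F₄ b' * F₃ b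
      exact mul_nonneg (by linarith) (by linarith)
    · have e1 := mlr₁₂ b' b hb1' hbb hb2
      have e2 := mlr₃₄ b' b hb1' hbb hb2
      exact mul_nonneg_of_nonpos_of_nonpos (by linarith) (by linarith)
  -- Cauchy–Binet: the real Gram kernel of the Perron vectors is TP₂
  have tp := gram_tp2_of_sameSign (Finset.univ : Finset (Fin 2 × Fin m → Fin 2))
    (fun σ => (φ₁ σ).re) (fun σ => (φ₂ σ).re) (fun σ => (φ₃ σ).re) (fun σ => (φ₄ σ).re)
    (fun σ _ σ' _ => hsign σ σ')
  -- tp : (Σ φ₁φ₄)(Σ φ₂φ₃) ≤ (Σ φ₁φ₃)(Σ φ₂φ₄)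
  have hK : ∀ {c c' : ℂ} {ψ₀ ψ₀' : (Fin 2 × Fin m → Fin 2) → ℂ},
      (∀ σ, 0 ≤ (ψ₀ σ).re ∧ (ψ₀ σ).im = 0) → (∀ σ, 0 ≤ (ψ₀' σ).re ∧ (ψ₀' σ).im = 0) →
      ‖star (c • ψ₀) ⬝ᵥ (c' • ψ₀')‖ = ‖c‖ * ‖c'‖ * ∑ σ, (ψ₀ σ).re * (ψ₀' σ).re := by
    intro c c' ψ₀ ψ₀' h h'
    rw [star_dotProduct_of_real_smul (fun σ => (h σ).2) (fun σ => (h' σ).2), norm_mul, norm_mul,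
      Complex.star_def, Complex.norm_conj, Complex.norm_real,
      Real.norm_of_nonneg (Finset.sum_nonneg fun σ _ => mul_nonneg (h σ).1 (h' σ).1)]
  rw [hc₁, hc₂, hc₃, hc₄, hK hnn₁ hnn₄, hK hnn₂ hnn₃, hK hnn₁ hnn₃, hK hnn₂ hnn₄]
  have hpos : 0 ≤ ‖c₁‖ * ‖c₂‖ * ‖c₃‖ * ‖c₄‖ := by positivity
  have key := mul_le_mul_of_nonneg_left tp hpos
  have e1 : ‖c₁‖ * ‖c₄‖ * (∑ σ, (φ₁ σ).re * (φ₄ σ).re) * (‖c₂‖ * ‖c₃‖ * ∑ σ, (φ₂ σ).re * (φ₃ σ).re) =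
      ‖c₁‖ * ‖c₂‖ * ‖c₃‖ * ‖c₄‖ *
        ((∑ σ, (φ₁ σ).re * (φ₄ σ).re) * ∑ σ, (φ₂ σ).re * (φ₃ σ).re) := by ring
  have e2 : ‖c₁‖ * ‖c₃‖ * (∑ σ, (φ₁ σ).re * (φ₃ σ).re) * (‖c₂‖ * ‖c₄‖ * ∑ σ, (φ₂ σ).re * (φ₄ σ).re) =
      ‖c₁‖ * ‖c₂‖ * ‖c₃‖ * ‖c₄‖ *
        ((∑ σ, (φ₁ σ).re * (φ₃ σ).re) * ∑ σ, (φ₂ σ).re * (φ₄ σ).re) := by ring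
  rw [e1, e2]
  exact key

/-- **(OM) on `K_{m,m}`, every sector, all real anisotropies**: for `Δ₁ ≤ Δ₁' ≤ Δ₂` and normalised
sector ground states `ψ₁, ψ₁', φ` of `H(Δ₁), H(Δ₁'), H(Δ₂)` in one sector,
`|⟨ψ₁, φ⟩| ≤ |⟨ψ₁', φ⟩|` (TP₂ with unit diagonal + Cauchy–Schwarz). [folklore] -/
theorem completeBipartite_overlapMonotone (hm : 0 < m) {M Δ₁ Δ₁' Δ₂ : ℝ} (h1 : Δ₁ ≤ Δ₁') (h2 : Δ₁' ≤ Δ₂)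
    {ψ₁ ψ₁' φ : TensorIndex (Fin 2 × Fin m) 2 → ℂ}
    (g₁m : ψ₁ ∈ spinZSector (Λ := Fin 2 × Fin m) 1 M) (g₁n : star ψ₁ ⬝ᵥ ψ₁ = 1)
    (g₁e : xxzHamiltonian 1 (SimpleGraph.completeEquipartiteGraph 2 m) (-1) Δ₁ *ᵥ ψ₁ =
      ((lowestEnergyInSector 1 (xxzHamiltonian 1 (SimpleGraph.completeEquipartiteGraph 2 m) (-1) Δ₁)
        M : ℝ) : ℂ) • ψ₁)
    (g₁'m : ψ₁' ∈ spinZSector (Λ := Fin 2 × Fin m) 1 M) (g₁'n : star ψ₁' ⬝ᵥ ψ₁' = 1)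
    (g₁'e : xxzHamiltonian 1 (SimpleGraph.completeEquipartiteGraph 2 m) (-1) Δ₁' *ᵥ ψ₁' =
      ((lowestEnergyInSector 1 (xxzHamiltonian 1 (SimpleGraph.completeEquipartiteGraph 2 m) (-1) Δ₁')
        M : ℝ) : ℂ) • ψ₁')
    (gφm : φ ∈ spinZSector (Λ := Fin 2 × Fin m) 1 M) (gφn : star φ ⬝ᵥ φ = 1)
    (gφe : xxzHamiltonian 1 (SimpleGraph.completeEquipartiteGraph 2 m) (-1) Δ₂ *ᵥ φ =
      ((lowestEnergyInSector 1 (xxzHamiltonian 1 (SimpleGraph.completeEquipartiteGraph 2 m) (-1) Δ₂)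
        M : ℝ) : ℂ) • φ) :
    ‖star ψ₁ ⬝ᵥ φ‖ ≤ ‖star ψ₁' ⬝ᵥ φ‖ := by
  have tp := completeBipartite_gramTP2 hm h1 h2 g₁m g₁n g₁e g₁'m g₁'n g₁'e g₁'m g₁'n g₁'e gφm gφn gφe
  rw [g₁'n, norm_one, mul_one] at tp
  have hcs : ‖star ψ₁ ⬝ᵥ ψ₁'‖ ≤ 1 := norm_star_dotProduct_le_one_of_unit g₁n g₁'n
  calc ‖star ψ₁ ⬝ᵥ φ‖ ≤ ‖star ψ₁ ⬝ᵥ ψ₁'‖ * ‖star ψ₁' ⬝ᵥ φ‖ := tp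
    _ ≤ 1 * ‖star ψ₁' ⬝ᵥ φ‖ := by gcongr
    _ = ‖star ψ₁' ⬝ᵥ φ‖ := one_mul _

/-- **The `K_{m,m}` slice of CONJECTURE TP-VT is a theorem in every sector** (statement in the binder
shape of `VertexTransitiveGroundStateGramTP2` with `G = completeEquipartiteGraph 2 m`, `m ≥ 1`; the
window hypotheses are not used). [folklore] -/
theorem completeBipartite_gramTP2_slice (m : ℕ) (hm : 0 < m) :
    ∀ (M Δ₁ Δ₂ Δ₃ Δ₄ : ℝ),
      -1 ≤ Δ₁ → Δ₁ ≤ Δ₂ → Δ₂ ≤ 1 → -1 ≤ Δ₃ → Δ₃ ≤ Δ₄ → Δ₄ ≤ 1 →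
      ∀ ψ₁ ψ₂ ψ₃ ψ₄ : TensorIndex (Fin 2 × Fin m) 2 → ℂ,
        ψ₁ ∈ spinZSector (Λ := Fin 2 × Fin m) 1 M → star ψ₁ ⬝ᵥ ψ₁ = 1 →
        xxzHamiltonian 1 (SimpleGraph.completeEquipartiteGraph 2 m) (-1) Δ₁ *ᵥ ψ₁ =
          ((lowestEnergyInSector 1 (xxzHamiltonian 1 (SimpleGraph.completeEquipartiteGraph 2 m) (-1) Δ₁) M : ℝ) : ℂ) • ψ₁ →
        ψ₂ ∈ spinZSector (Λ := Fin 2 × Fin m) 1 M → star ψ₂ ⬝ᵥ ψ₂ = 1 →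
        xxzHamiltonian 1 (SimpleGraph.completeEquipartiteGraph 2 m) (-1) Δ₂ *ᵥ ψ₂ =
          ((lowestEnergyInSector 1 (xxzHamiltonian 1 (SimpleGraph.completeEquipartiteGraph 2 m) (-1) Δ₂) M : ℝ) : ℂ) • ψ₂ →
        ψ₃ ∈ spinZSector (Λ := Fin 2 × Fin m) 1 M → star ψ₃ ⬝ᵥ ψ₃ = 1 →
        xxzHamiltonian 1 (SimpleGraph.completeEquipartiteGraph 2 m) (-1) Δ₃ *ᵥ ψ₃ =
          ((lowestEnergyInSector 1 (xxzHamiltonian 1 (SimpleGraph.completeEquipartiteGraph 2 m) (-1) Δ₃) M : ℝ) : ℂ) • ψ₃ →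
        ψ₄ ∈ spinZSector (Λ := Fin 2 × Fin m) 1 M → star ψ₄ ⬝ᵥ ψ₄ = 1 →
        xxzHamiltonian 1 (SimpleGraph.completeEquipartiteGraph 2 m) (-1) Δ₄ *ᵥ ψ₄ =
          ((lowestEnergyInSector 1 (xxzHamiltonian 1 (SimpleGraph.completeEquipartiteGraph 2 m) (-1) Δ₄) M : ℝ) : ℂ) • ψ₄ →
        ‖star ψ₁ ⬝ᵥ ψ₄‖ * ‖star ψ₂ ⬝ᵥ ψ₃‖ ≤ ‖star ψ₁ ⬝ᵥ ψ₃‖ * ‖star ψ₂ ⬝ᵥ ψ₄‖ :=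
  fun _ _ _ _ _ _ h12 _ _ h34 _ _ _ _ _ g₁m g₁n g₁e g₂m g₂n g₂e g₃m g₃n g₃e g₄m g₄n g₄e =>
    completeBipartite_gramTP2 hm h12 h34 g₁m g₁n g₁e g₂m g₂n g₂e g₃m g₃n g₃e g₄m g₄n g₄e

end Summit.HubbardSuperconductivity.HubbardSuperconductivity.Theorems.AnisotropyChord
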